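import Summits.AtomisticToContinuum.Crystallization.Theorems.FreeSplittingCertificatesStrictSplittingRuleTorusModel663A
import Summits.AtomisticToContinuum.Crystallization.Theorems.FreeSplittingCertificatesStrictSplittingRuleTorusModel663B
import Summits.AtomisticToContinuum.Crystallization.Theorems.FreeSplittingCertificatesStrictSplittingRuleTorusQFormReal

/-!
# The joint (r6) sitewise LMI on the hcp torus 6×6×3 for `R`-valued (e.g. REAL) displacement fields — both parities

Route `FreeSplittingCertificates`, crux `StrictSplittingRule` (stmt-AtomisticToContinuum-12560); unit b2b-freesplit-B (block 2b,
PART B, gen 2).  **VALUE = theorems about a FINITE model — NOT summit progress**; `stub_coreJointCoercive` is not proved.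

The block (congruence) certificates of `…TorusModel663A/B.lean` are rational; as in `…TorusModel442Real.lean` the conclusion transfers to
every linearly ordered field `R`: the Gram-matrix equality `gramEq663A/B` makes the model's form and the block form `Σ_k y_kᵀ N_k y_k` agree
over `R` as well (`evalQR_eq_of_symm_assemble_eq`), and each `PSD.IsGramCertDD` block is nonnegative over `R`
(`blockTerms_nonnegR`).  Theorems `jointLMI663A_real`, `jointLMI663B_real` (+ zero-mean forms) for `u : Fin 648 → R`.  [folklore]
-/

namespace Summit.AtomisticToContinuum.Crystallization.Theorems.StrictSplittingRuleTorusLMI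

open Literature.Computation.Certificates

variable {N : ℕ} {R : Type*} [Field R] [LinearOrder R] [IsStrictOrderedRing R]

/-! ## Generic: the block glue over `R` -/

omit [LinearOrder R] [IsStrictOrderedRing R] in
/-- `evalQR (negTermsN ts) = −evalQR ts` (generic dimension). [folklore] -/
theorem evalQR_negTermsN [CharZero R] (ts : List (Term N)) (u : Fin N → R) : evalQR (negTermsN ts) u = -evalQR ts u := by
  induction ts with
  | nil => simp [negTermsN]
  | cons t ts ih =>
    simp only [negTermsN, List.map_cons, evalQR_cons] at ih ⊢
    rw [ih]; push_cast; ring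

omit [LinearOrder R] [IsStrictOrderedRing R] in
/-- `evalQR (scaleTermsN a ts) = a · evalQR ts` (generic dimension). [folklore] -/
theorem evalQR_scaleTermsN [CharZero R] (a : ℚ) (ts : List (Term N)) (u : Fin N → R) :
    evalQR (scaleTermsN a ts) u = (a : R) * evalQR ts u := by
  induction ts with
  | nil => simp [scaleTermsN]
  | cons t ts ih =>
    simp only [scaleTermsN, List.map_cons, evalQR_cons] at ih ⊢
    rw [ih]; push_cast; ring

/-- Two term lists with the same symmetrised Gram matrix define the same form over `R`. [folklore] -/
theorem evalQR_eq_of_symm_assemble_eq {ts ts' : List (Term N)}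
    (h : symm (assemble ts).toMatrix = symm (assemble ts').toMatrix) (u : Fin N → R) : evalQR ts u = evalQR ts' u := by
  rw [evalQR_eq_quadForm, evalQR_eq_quadForm, ← toMatrix_assemble ts, ← toMatrix_assemble ts',
    ← quadForm_symmR (assemble ts).toMatrix u, h, quadForm_symmR]

omit [LinearOrder R] [IsStrictOrderedRing R] in
/-- `evalQR` of a `flatMap`. [folklore] -/
theorem evalQR_flatMapN {α : Type*} (l : List α) (f : α → List (Term N)) (u : Fin N → R) :
    evalQR (l.flatMap f) u = (l.map fun a => evalQR (f a) u).sum := by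
  induction l with
  | nil => simp
  | cons a l ih => rw [List.flatMap_cons, evalQR_append, ih, List.map_cons, List.sum_cons]

omit [LinearOrder R] [IsStrictOrderedRing R] in
/-- The block term list over `R` is the quadratic form of `N` in `y_a = r_a(u)`. [folklore] -/
theorem evalQR_blockTerms {d : ℕ} (Nk : Matrix (Fin d) (Fin d) ℚ) (rows : Fin d → LinF N) (u : Fin N → R) :
    evalQR (blockTerms Nk rows) u = ∑ a, ∑ b, (rows a).evalR u * (Nk a b : R) * (rows b).evalR u := by
  rw [blockTerms, evalQR_flatMapN, Fin.sum_univ_def]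
  congr 1
  refine List.map_congr_left fun a _ => ?_
  rw [Fin.sum_univ_def, evalQR, List.map_map]
  congr 1
  refine List.map_congr_left fun b _ => ?_
  simp only [Function.comp]
  ring

/-- A rounded Gram certificate of `N` makes the block term list nonnegative over `R`. [folklore] -/
theorem blockTerms_nonnegR {d m : ℕ} {Nk : Matrix (Fin d) (Fin d) ℚ} {dv : Fin m → ℚ} {F : Matrix (Fin m) (Fin d) ℚ}
    (h : PSD.IsGramCertDD Nk dv F) (rows : Fin d → LinF N) (u : Fin N → R) : 0 ≤ evalQR (blockTerms Nk rows) u := by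
  rw [evalQR_blockTerms]
  exact h.quadForm_nonneg (R := R) (fun a => (rows a).evalR u)

/-- Nonnegativity over `R` is additive over concatenated term lists. [folklore] -/
theorem evalQR_append_nonneg {ts ts' : List (Term N)} (h : ∀ u : Fin N → R, 0 ≤ evalQR ts u)
    (h' : ∀ u : Fin N → R, 0 ≤ evalQR ts' u) (u : Fin N → R) : 0 ≤ evalQR (ts ++ ts') u := by
  rw [evalQR_append]; exact add_nonneg (h u) (h' u)

/-! ## The 6×6×3 forms over `R` and the theorems -/

/-- SUPPLY (6×6×3) at an `R`-valued field. [folklore] -/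
def supplyR6 (p : SiteG 6 6) (u : Fin (dimG 6 6) → R) : R := evalQR (supplyTermsG 6 6 p (thetaListG 6 6 p)) u
/-- TRANSFERS (6×6×3) at an `R`-valued field. [folklore] -/
def transferR6 (p : SiteG 6 6) (u : Fin (dimG 6 6) → R) : R := evalQR (transferTermsG 6 6 p tableClasses663) u
/-- DEMAND (6×6×3) at an `R`-valued field. [folklore] -/
def demandR6 (p : SiteG 6 6) (u : Fin (dimG 6 6) → R) : R :=
  evalQR (kappaTermsG 6 6 p (thetaListG 6 6 p)) u + evalQR (readoutTermsG 6 6 p (thetaListG 6 6 p) betaTable) u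
/-- `‖u‖²_G` (6×6×3) at an `R`-valued field. [folklore] -/
def normSqGR6 (u : Fin (dimG 6 6) → R) : R := evalQR (normTermsG 6 6) u
/-- `meanProj` (6×6×3) at an `R`-valued field. [folklore] -/
def meanProjR6 (u : Fin (dimG 6 6) → R) : R := evalQR (projTermsG 6 6) u

omit [LinearOrder R] [IsStrictOrderedRing R] in
/-- The certificate's form over `R`. [folklore] -/
theorem evalQR_certTermsG_663 [CharZero R] (p : SiteG 6 6) (mg : ℚ) (u : Fin (dimG 6 6) → R) :
    evalQR (certTermsG 6 6 p 1 mg tableClasses663) u =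
      supplyR6 p u + transferR6 p u - demandR6 p u - (mg : R) * normSqGR6 u + meanProjR6 u := by
  simp only [certTermsG, evalQR_append, evalQR_negTermsN, evalQR_scaleTermsN, supplyR6, transferR6, demandR6, normSqGR6,
    meanProjR6]
  push_cast
  ring

/-- `meanProjR6` vanishes on zero-mean fields. [folklore] -/
theorem meanProjR6_eq_zero {u : Fin (dimG 6 6) → R} (h0 : ∀ c : Fin 3, (sumFG 6 6 c).evalR u = 0) : meanProjR6 u = 0 := by
  simp [meanProjR6, projTermsG, sqN, evalQR_cons, h0]

/-- The block form of parity A is nonnegative over `R`. -/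
theorem blkTerms663A_nonnegR : ∀ u : Fin (dimG 6 6) → R, 0 ≤ evalQR blkTerms663A u := by
  intro u
  unfold blkTerms663A
  exact evalQR_append_nonneg (evalQR_append_nonneg (evalQR_append_nonneg (evalQR_append_nonneg (evalQR_append_nonneg
    (evalQR_append_nonneg (evalQR_append_nonneg (blockTerms_nonnegR cert663A0_valid _) (blockTerms_nonnegR cert663A1_valid _))
    (blockTerms_nonnegR cert663A2_valid _)) (blockTerms_nonnegR cert663A3_valid _)) (blockTerms_nonnegR cert663A4_valid _))
    (blockTerms_nonnegR cert663A5_valid _)) (blockTerms_nonnegR cert663A6_valid _)) (blockTerms_nonnegR cert663A7_valid _) u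

/-- The block form of parity B is nonnegative over `R`. -/
theorem blkTerms663B_nonnegR : ∀ u : Fin (dimG 6 6) → R, 0 ≤ evalQR blkTerms663B u := by
  intro u
  unfold blkTerms663B
  exact evalQR_append_nonneg (evalQR_append_nonneg (evalQR_append_nonneg (evalQR_append_nonneg (evalQR_append_nonneg
    (evalQR_append_nonneg (evalQR_append_nonneg (blockTerms_nonnegR cert663B0_valid _) (blockTerms_nonnegR cert663B1_valid _))
    (blockTerms_nonnegR cert663B2_valid _)) (blockTerms_nonnegR cert663B3_valid _)) (blockTerms_nonnegR cert663B4_valid _))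
    (blockTerms_nonnegR cert663B5_valid _)) (blockTerms_nonnegR cert663B6_valid _)) (blockTerms_nonnegR cert663B7_valid _) u

/-- **The joint (r6) sitewise LMI at the A site of the 6×6×3 torus for `R`-valued (e.g. REAL) fields**, margin `3/500`. -/
theorem jointLMI663A_real (u : Fin (dimG 6 6) → R) :
    demandR6 siteA6 u + (margin663 : R) * normSqGR6 u ≤ supplyR6 siteA6 u + transferR6 siteA6 u + meanProjR6 u := by
  have hEq : mat663A = symm blkAcc663A.toMatrix := funext fun i => funext fun j => gramEq663A i j
  have h := blkTerms663A_nonnegR u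
  rw [← evalQR_eq_of_symm_assemble_eq (ts := certTermsG 6 6 siteA6 1 margin663 tableClasses663) hEq u,
    evalQR_certTermsG_663] at h
  linarith

/-- **The joint (r6) sitewise LMI at the B site of the 6×6×3 torus for `R`-valued fields**, margin `3/500`. -/
theorem jointLMI663B_real (u : Fin (dimG 6 6) → R) :
    demandR6 siteB6 u + (margin663 : R) * normSqGR6 u ≤ supplyR6 siteB6 u + transferR6 siteB6 u + meanProjR6 u := by
  have hEq : mat663B = symm blkAcc663B.toMatrix := funext fun i => funext fun j => gramEq663B i j
  have h := blkTerms663B_nonnegR u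
  rw [← evalQR_eq_of_symm_assemble_eq (ts := certTermsG 6 6 siteB6 1 margin663 tableClasses663) hEq u,
    evalQR_certTermsG_663] at h
  linarith

/-- **Zero-mean form, A site, `R`-valued fields.** -/
theorem jointLMI663A_real_zeroMean (u : Fin (dimG 6 6) → R) (h0 : ∀ c : Fin 3, (sumFG 6 6 c).evalR u = 0) :
    demandR6 siteA6 u + (margin663 : R) * normSqGR6 u ≤ supplyR6 siteA6 u + transferR6 siteA6 u := by
  have h := jointLMI663A_real u
  rw [meanProjR6_eq_zero h0, add_zero] at h
  exact h

/-- **Zero-mean form, B site, `R`-valued fields.** -/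
theorem jointLMI663B_real_zeroMean (u : Fin (dimG 6 6) → R) (h0 : ∀ c : Fin 3, (sumFG 6 6 c).evalR u = 0) :
    demandR6 siteB6 u + (margin663 : R) * normSqGR6 u ≤ supplyR6 siteB6 u + transferR6 siteB6 u := by
  have h := jointLMI663B_real u
  rw [meanProjR6_eq_zero h0, add_zero] at h
  exact h

end Summit.AtomisticToContinuum.Crystallization.Theorems.StrictSplittingRuleTorusLMI
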